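import Literature.NumberTheory.EllipticCurves.ZpExtensionCoeffAdicTower
import Literature.NumberTheory.EllipticCurves.LambdaAdicSelmerDataToCoeffTwistH1Linear
import HarnessLib

/-!
# The comparison map `Φ : 𝔖_p(K_∞) → lim_k H¹(K, E[p^k] ⊗ (Λ/I_k)(ψ⁻¹))` from Perrin-Riou's `Λ`-adic Selmer module
# (the pin `LambdaAdicSelmerData`) into the `Λ`-adic source tower of `ZpExtensionCoeffAdicTower`, and its `Λ`-LINEARITY
# (definitions with bodies + theorems)

Topic `NumberTheory/EllipticCurves` (sequel of `ZpExtensionCoeffAdicTower`, `LambdaAdicSelmerDataToCoeffTwistH1[Linear]`).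
Cell `pub/bsd-print-x9`, seat `bsd-line-x9-p2` (g3): the (L3) COMPARISON of STUB 2 of the shared μ-item of crux
stmt-BirchSwinnertonDyer-27077 (x9-p1 LEAD g3 14:00:43Z (L3); lit g31 16:15:31Z: «'limitH1/limitSelmer' of this tower is
LITERALLY the group of norm- and reduction-compatible families … up to YOUR comparison Φ — the right theorem to build»;
LEAD 17:06:30Z: «(F-411) typed on the Shapiro-diagonal source … κ.one = Φ(κ_∞^{st})»).

Setting: `E = V` elliptic over a number field `K` with `E(K)[p] = 0`, `κ : ZpExtension K p` with topological generator `γ`,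
`D : V.LambdaAdicSelmerData κ γ` (`𝔖 = 𝔖_p(K_∞)`), an antitone family of open ideals `I : ℕ → Ideal Λ` with `ω_{J k} ∈ I k`
and `𝔪^{e k} ≤ I k`, equivariant lifts `t k` of `P ↦ p P` on `E[p^{k+1}] → E[p^k]` (surjective), and the SOURCE tower
`T := κ⁻.coeffAdicTower (E[p^·]) t I …` at the inverse extension `κ⁻ = κ.unitTwist (-1)` (levels `E[p^k] ⊗ (Λ/I_k)(ψ⁻¹)`;
for `I k = (ω_k, p^k)` Howard's `𝐓 = lim← Ind_{K_k/K} E[p^k]`, Def. 2.2.3).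

* `toCoeffFamily D … s : ∀ k, H¹(K, T_k)` — `k ↦ coeffComponent` at the canonical layer `J k`;
  `toCoeffFamily_mem_limitH1` (compatibility, `map_coeffTwistReduce_coeffComponent_reduce_self` + `redH1_coeffAdicTower`);
* **`toCoeffLimitH1 D … : D.S →+ T.limitH1`** — THE COMPARISON `Φ` (Howard's `𝔖 = H¹(K, 𝐓)` presented on the pin); `_apply`;
* **`toCoeffLimitH1_smul`**: `Φ (g • s) = T.smulFamily g (Φ s)` for every `g ∈ Λ`, given `X^{k p^{n k}} ∈ I k` at layers
  `n k ≥ J k` (e.g. `I k = (ω_k, p^k)`, `n k = k`: `X_pow_mem_shapiroIdeal`) — `Φ` is a map of `Λ`-modules in the tower's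
  scalar action `AdicTower.smulFamily` (the currency of `DVRSetting.KolyvaginSystem.one`, `IsFreeRankOneOn`);
* `fH1_toCoeffLimitH1_eq_eisensteinComponent`-type hook is `map_coeffTwistReduce_coeffComponent_eq_eisensteinComponent`
  (file `…ToCoeffTwistH1`): after Howard's ring change `Λ → S_𝔮` the components of `Φ z` ARE D1's control components.
DEFINITIONS WITH BODIES + theorems; no named fact, no instance, no notation, no `sorry`. Not here: injectivity of `Φ` and
`Φ(𝔖) = limitSelmer(F_Λ)` (Shapiro's lemma for `Ind_{K_k/K}`, cores ∘ (1 ⊗ ·) an isomorphism — the F_Λ Selmer triples of the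
source are lit tranche 5); the statement of (F-411) itself. BSD is not proved by any of this.

References: [Howard2004HeegnerKolyvagin] B. Howard, Compositio Math. 140 (2004), §2.2 Def. 2.2.1–2.2.3 (arXiv:1202.6340 §3.2,
p0016 L12–55), §1.6, proof of Thm. 2.2.10 (p0017 L78–81); [PerrinRiou1987BSMF] §0 pp. 401–402; [CastellaGrossiLeeSkinner2022]
Thm. 4.1.1 and Rem. 4.1.4 (κ_∞ and κ₁^{Hg} in H¹_{F_Λ}(K, 𝐓)); [Washington1997] §13.1–§13.2.
-/

noncomputable section

open scoped Topology Classical ContRepresentation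
open Field CategoryTheory IsLocalRing

namespace WeierstrassCurve.LambdaAdicSelmerData

open Literature.NumberTheory.EllipticCurves Literature.NumberTheory.GaloisRepresentations
open Literature.NumberTheory.EllipticCurves.ZpExtension (mk_one_add_X_pow_prime_pow_eq_one coeffAdicTower coeffLevelUnit
  CoeffLevel)
open Literature.NumberTheory.GaloisCohomology.Howard2004

variable {K : Type} [Field K] [NumberField K] {V : WeierstrassCurve K} [V.IsElliptic] {p : ℕ} [hp : Fact p.Prime]
  {κ : ZpExtension K p} {γ : absoluteGaloisGroup K} (D : V.LambdaAdicSelmerData κ γ)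
  (t : ∀ k, (V.torsionGaloisModule ((p : ℤ) ^ (k + 1))).toContRepresentation →ⁱL
    (V.torsionGaloisModule ((p : ℤ) ^ k)).toContRepresentation)
  (ht : ∀ k (P : geomTorsion V ((p : ℤ) ^ (k + 1))), t k P = V.geomTorsionReduce p k P)
  (hts : ∀ k, Function.Surjective (t k))
  (I : ℕ → Ideal (IwasawaAlgebra p)) (hI : ∀ k, I (k + 1) ≤ I k)
  (J : ℕ → ℕ) (hJ : ∀ k, ((1 + PowerSeries.X : IwasawaAlgebra p) ^ (p ^ J k) - 1) ∈ I k)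
  (e : ℕ → ℕ) (he : ∀ k, maximalIdeal (IwasawaAlgebra p) ^ e k ≤ I k)

/-- **The family of source-tower components of `s ∈ 𝔖_p(K_∞)`**: `k ↦ coeffComponent_k s ∈ H¹(K, E[p^k] ⊗ (Λ/I_k)(ψ⁻¹))` at
the canonical layer `J k` (any layer `≥ J k` gives the same class, `coeffComponent_eq_of_le`), as an element of the product of
the levels' cohomology groups of the source tower `κ⁻.coeffAdicTower …`.
[cite: Howard2004HeegnerKolyvagin, §2.2 Def. 2.2.3 (𝐓 = lim← Ind_{K_n/K} T; 𝔖 = H¹(K, 𝐓))] -/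
def toCoeffFamily (s : D.S) :
    ∀ k, galoisCohomology (((κ.unitTwist (-1)).coeffAdicTower (fun k ↦ V.torsionGaloisModule ((p : ℤ) ^ k)) t I hI J hJ e
      he hts).ρ k) 1 :=
  fun k ↦ D.coeffComponent (mk_one_add_X_pow_prime_pow_eq_one (I k) (hJ k)) k (J k) le_rfl s

omit [V.IsElliptic] in
/-- Unfolding `toCoeffFamily`. [cite: Howard2004HeegnerKolyvagin, §2.2] -/
theorem toCoeffFamily_apply (s : D.S) (k : ℕ) :
    D.toCoeffFamily t hts I hI J hJ e he s k =
      D.coeffComponent (mk_one_add_X_pow_prime_pow_eq_one (I k) (hJ k)) k (J k) le_rfl s :=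
  rfl

omit [V.IsElliptic] in
/-- `toCoeffFamily` is additive. [cite: Howard2004HeegnerKolyvagin, §2.2] -/
theorem toCoeffFamily_add (s s' : D.S) :
    D.toCoeffFamily t hts I hI J hJ e he (s + s') = D.toCoeffFamily t hts I hI J hJ e he s + D.toCoeffFamily t hts I hI J hJ e he s' :=
  funext fun k ↦ map_add (D.coeffComponent (mk_one_add_X_pow_prime_pow_eq_one (I k) (hJ k)) k (J k) le_rfl) s s'

include ht in
/-- **The components are compatible under the tower's reductions**: `toCoeffFamily s ∈ lim_k H¹(K, T_k)` (`E(K)[p] = 0`,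
`γ` a topological generator; `map_coeffTwistReduce_coeffComponent_reduce_self` + `redH1_coeffAdicTower`).
[cite: Howard2004HeegnerKolyvagin, §2.2 Def. 2.2.3 and §1.6 (arXiv p. 12)] [cite: PerrinRiou1987BSMF, §0 p. 402] -/
theorem toCoeffFamily_mem_limitH1 (hγ : κ.IsTopGenerator γ) (hE : ∀ P : V.toAffine.Point, p • P = 0 → P = 0) (s : D.S) :
    D.toCoeffFamily t hts I hI J hJ e he s ∈
      ((κ.unitTwist (-1)).coeffAdicTower (fun k ↦ V.torsionGaloisModule ((p : ℤ) ^ k)) t I hI J hJ e he hts).limitH1 := by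
  rw [ZpExtension.mem_limitH1_coeffAdicTower_iff]
  intro k
  exact D.map_coeffTwistReduce_coeffComponent_reduce_self (mk_one_add_X_pow_prime_pow_eq_one (I (k + 1)) (hJ (k + 1)))
    (mk_one_add_X_pow_prime_pow_eq_one (I k) (hJ k)) (Ideal.Quotient.factor (hI k))
    (ZpExtension.factor_coeffLevelUnit I hI k) t ht hγ hE k s

/-- **The comparison `Φ : 𝔖_p(K_∞) → lim_k H¹(K, E[p^k] ⊗ (Λ/I_k)(ψ⁻¹))`** (additive; `Λ`-linearity below): Perrin-Riou's pinned
`𝔖` mapped into Howard's `H¹(K, 𝐓) = lim_k H¹(K, 𝐓/I_k𝐓)` on the `Λ`-adic source tower — the map through which the cite-only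
(F-411) ties CGLS's `κ₁^{Hg}` to the tree's stabilised class `κ_∞` («κ.one = Φ(κ_∞)», CGLS Rem. 4.1.4).
[cite: Howard2004HeegnerKolyvagin, §2.2 Def. 2.2.3 (𝔖 ≅ H¹(K, 𝐓)) and proof of Thm. 2.2.10 (p0017 L78–81)]
[cite: CastellaGrossiLeeSkinner2022, Rem. 4.1.4] -/
def toCoeffLimitH1 (hγ : κ.IsTopGenerator γ) (hE : ∀ P : V.toAffine.Point, p • P = 0 → P = 0) :
    D.S →+ ((κ.unitTwist (-1)).coeffAdicTower (fun k ↦ V.torsionGaloisModule ((p : ℤ) ^ k)) t I hI J hJ e he hts).limitH1 where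
  toFun s := ⟨D.toCoeffFamily t hts I hI J hJ e he s, D.toCoeffFamily_mem_limitH1 t ht hts I hI J hJ e he hγ hE s⟩
  map_zero' := Subtype.ext (funext fun k ↦
    map_zero (D.coeffComponent (mk_one_add_X_pow_prime_pow_eq_one (I k) (hJ k)) k (J k) le_rfl))
  map_add' s s' := Subtype.ext (D.toCoeffFamily_add t hts I hI J hJ e he s s')

/-- Unfolding `toCoeffLimitH1`: its `k`-th component is `coeffComponent_k` at layer `J k`. [cite: Howard2004HeegnerKolyvagin, §2.2] -/
theorem toCoeffLimitH1_apply (hγ : κ.IsTopGenerator γ) (hE : ∀ P : V.toAffine.Point, p • P = 0 → P = 0) (s : D.S) (k : ℕ) :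
    (D.toCoeffLimitH1 t ht hts I hI J hJ e he hγ hE s).1 k =
      D.coeffComponent (mk_one_add_X_pow_prime_pow_eq_one (I k) (hJ k)) k (J k) le_rfl s :=
  rfl

/-- The `k`-th component of `Φ s` computed at ANY admissible layer `n ≥ J k`. [cite: Howard2004HeegnerKolyvagin, §2.2] -/
theorem toCoeffLimitH1_apply_eq (hγ : κ.IsTopGenerator γ) (hE : ∀ P : V.toAffine.Point, p • P = 0 → P = 0) (s : D.S)
    (k : ℕ) {n : ℕ} (hn : J k ≤ n) :
    (D.toCoeffLimitH1 t ht hts I hI J hJ e he hγ hE s).1 k =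
      D.coeffComponent (mk_one_add_X_pow_prime_pow_eq_one (I k) (hJ k)) k n hn s := by
  rw [toCoeffLimitH1_apply, D.coeffComponent_eq_self _ hγ hE k hn]

variable (n : ℕ → ℕ) (hn : ∀ k, J k ≤ n k) (hX : ∀ k, (PowerSeries.X : IwasawaAlgebra p) ^ (k * p ^ n k) ∈ I k)

include hn hX in
/-- **`Φ` is `Λ`-linear** in the tower's scalar action: `Φ (g • s) = smulFamily g (Φ s)` for every `g ∈ Λ` — levelwise
`coeffComponent_smul` at a layer `n k ≥ J k` with `X^{k p^{n k}} ∈ I k` (the openness used for continuity), and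
`smulFamily_coeffAdicTower` (`smulFamily g` is `H¹([g] •)` levelwise). [cite: Howard2004HeegnerKolyvagin, §2.2 Def. 2.2.3 (𝔖 ≅ H¹(K, 𝐓) as Λ-modules)]
[cite: PerrinRiou1987BSMF, §0 p. 402] -/
theorem toCoeffLimitH1_smul (hγ : κ.IsTopGenerator γ) (hE : ∀ P : V.toAffine.Point, p • P = 0 → P = 0)
    (g : IwasawaAlgebra p) (s : D.S) :
    (D.toCoeffLimitH1 t ht hts I hI J hJ e he hγ hE (g • s)).1 =
      ((κ.unitTwist (-1)).coeffAdicTower (fun k ↦ V.torsionGaloisModule ((p : ℤ) ^ k)) t I hI J hJ e he hts).smulFamily g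
        (D.toCoeffLimitH1 t ht hts I hI J hJ e he hγ hE s).1 := by
  funext k
  rw [ZpExtension.smulFamily_coeffAdicTower, D.toCoeffLimitH1_apply_eq t ht hts I hI J hJ e he hγ hE _ k (hn k),
    D.toCoeffLimitH1_apply_eq t ht hts I hI J hJ e he hγ hE _ k (hn k),
    D.coeffComponent_smul (hJ k) hγ k (n k) (hn k) (hX k) le_rfl g s]

include hn hX in
/-- **Each component of `Φ` is `Λ`-linear** (element form of `toCoeffLimitH1_smul`: `Φ(g • s)_k = H¹([g]_{Λ/I_k} •) (Φ s)_k`).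
[cite: Howard2004HeegnerKolyvagin, §2.2 Def. 2.2.3] -/
theorem toCoeffLimitH1_apply_smul (hγ : κ.IsTopGenerator γ) (hE : ∀ P : V.toAffine.Point, p • P = 0 → P = 0)
    (g : IwasawaAlgebra p) (s : D.S) (k : ℕ) :
    (D.toCoeffLimitH1 t ht hts I hI J hJ e he hγ hE (g • s)).1 k =
      galoisCohomology.map ((κ.unitTwist (-1)).coeffTwistSMulHom (V.torsionGaloisModule ((p : ℤ) ^ k))
        (mk_one_add_X_pow_prime_pow_eq_one (I k) (hJ k)) (Ideal.Quotient.mk (I k) g)) 1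
        ((D.toCoeffLimitH1 t ht hts I hI J hJ e he hγ hE s).1 k) := by
  rw [D.toCoeffLimitH1_smul t ht hts I hI J hJ e he n hn hX hγ hE g s, ZpExtension.smulFamily_coeffAdicTower]

/-! ## The Shapiro diagonal `I_k = (ω_k, p^k)` -/

/-- **`Φ` on Howard's Shapiro-diagonal source tower** `k ↦ E[p^k] ⊗ (Λ/(ω_k, p^k))(ψ⁻¹) = Ind_{K_k/K} E[p^k]`
(`shapiroIdeal`, `J k = k`, `e k = k p^k + k`): the comparison of Def. 2.2.3, in the kernel.
[cite: Howard2004HeegnerKolyvagin, §2.2 Def. 2.2.1–2.2.3 (arXiv p0016 L12–55)] -/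
def toShapiroLimitH1 (hγ : κ.IsTopGenerator γ) (hE : ∀ P : V.toAffine.Point, p • P = 0 → P = 0) :
    D.S →+ ((κ.unitTwist (-1)).coeffAdicTower (fun k ↦ V.torsionGaloisModule ((p : ℤ) ^ k)) t
      (ZpExtension.shapiroIdeal p) (ZpExtension.shapiroIdeal_succ_le p) (fun k ↦ k) (ZpExtension.omega_mem_shapiroIdeal p)
      (fun k ↦ k * p ^ k + k) (ZpExtension.maximalIdeal_pow_le_shapiroIdeal p) hts).limitH1 :=
  D.toCoeffLimitH1 t ht hts _ _ _ _ _ _ hγ hE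

/-- **`Φ` on the Shapiro-diagonal tower is `Λ`-linear** (`n k = k`: `X^{k p^k} ∈ (ω_k, p^k)`, `X_pow_mem_shapiroIdeal`).
[cite: Howard2004HeegnerKolyvagin, §2.2 Def. 2.2.3 (𝔖 ≅ H¹(K, 𝐓) as Λ-modules)] -/
theorem toShapiroLimitH1_smul (hγ : κ.IsTopGenerator γ) (hE : ∀ P : V.toAffine.Point, p • P = 0 → P = 0)
    (g : IwasawaAlgebra p) (s : D.S) :
    (D.toShapiroLimitH1 t ht hts hγ hE (g • s)).1 =
      ((κ.unitTwist (-1)).coeffAdicTower (fun k ↦ V.torsionGaloisModule ((p : ℤ) ^ k)) t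
        (ZpExtension.shapiroIdeal p) (ZpExtension.shapiroIdeal_succ_le p) (fun k ↦ k) (ZpExtension.omega_mem_shapiroIdeal p)
        (fun k ↦ k * p ^ k + k) (ZpExtension.maximalIdeal_pow_le_shapiroIdeal p) hts).smulFamily g
        (D.toShapiroLimitH1 t ht hts hγ hE s).1 :=
  D.toCoeffLimitH1_smul t ht hts _ _ _ _ _ _ (fun k ↦ k) (fun _ ↦ le_rfl) (ZpExtension.X_pow_mem_shapiroIdeal p) hγ hE g s

end WeierstrassCurve.LambdaAdicSelmerData

end
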